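import Summits.QuantumFields.BalabanUV.T4Continuum.Support.NE7TangentTransportCurvedRightInv
import Summits.QuantumFields.BalabanUV.T4Continuum.Support.NE3CpushGaugeCovariance
import HarnessLib

/-!
# NE7TopMismatchLetters — THE TOP MISMATCH `ω` OF THE CURVED (TT): it is the CORNER OSCILLATION of the representative's gauge (`ω ≤ 2·sup_z ‖u(M•z) − 1‖` for a
# pair over the same datum), it VANISHES for a corner-pinned gauge, and then F71's letter closes with `τ = a·(curl1C∕(1−θℓ))·(M^d∕M²)·Λ` — the FIBRE-PRESERVING
# (TT); letter (L4) of the curved (APE) programme, file 8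

Cell `pub-balaban`, rung (B)+1 sub-cell t4, lineage `b2b-balaban-t4-ne7-p1` (CRUX PROVER NE7 #1 = OWNER of row NE7), generation 76; memo
`t4/b2b-balaban-t4-ne7-p1-g76/TT-CURVED-LETTER.md` §2–§3.  File F74 (over F71 `NE7TangentTransportCurvedRightInv.tangent_transport_curved_rightInvW`, W1
`NE3CpushGaugeCovariance.cavgIter_gaugeAct` (`cavgIter (j+1) (U^u) = (cavgIter (j+1) U)^{u ∘ M•}`), `AveragingDeficitMultiLevelPrep.cavgIter_unitary_small`).
WHY (memo §2, the located point).  F70∕F71 price the curved tangent transport at `c_R·(Λ + 2·d·ω·C_F)` with `ω = ‖cavgIter (k+1) U − cavgIter (k+1) W‖_∞`; the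
defect closes only for `ω ≲ λ̂·M^{1−d}`.  THIS FILE identifies `ω` for the pairs the (APE) meets: a representative `U^u` of a field `U` over THE SAME top datum as the
background (`cavgIter (k+1) U = cavgIter (k+1) W`) has `ω ≤ 2·sup_z ‖u(M•z) − 1‖` — the corner oscillation of the gauge, NOT small at the order `M^{1−d}` for a
B8-type Landau gauge (`‖u − 1‖ = O(M²c_R b₀)`, E′) — and `ω = 0` when `u` is PINNED at the top corners (`u(M•z) = 1`); in that case F71 gives F66's `hTT` shape with
`τ = a·(curl1C∕(1−θℓ))·(M^d∕M²)·Λ`, of the closing order by F73.  So the curved (APE) wants a representative in a POINTED (corner-pinned) Landau gauge: «REP WITH A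
FIXED TOP» (memo §3 (i)); this file is its docking target.
WHAT ([folklore]; 0 def, 0 sorry).
§1 `norm_gaugeAct_sub_self_le` — `‖V^g(z,κ) − V(z,κ)‖ ≤ ‖g(z) − 1‖ + ‖g(z+e_κ) − 1‖` for unitary data; **`norm_cavgIter_gaugeAct_sub_le`** — for `U`, `W` of the class with
   `cavgIter (k+1) U = cavgIter (k+1) W` and unitary `u` with `‖u(M•z) − 1‖ ≤ θ`: `‖cavgIter (k+1) (U^u) (z,κ) − cavgIter (k+1) W (z,κ)‖ ≤ 2θ`;
   **`cavgIter_gaugeAct_eq_of_pinned`** — `= 0` mismatch: `cavgIter (k+1) (U^u) = cavgIter (k+1) W` when `u(M•z) = 1`.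
§2 **`tangent_transport_sameTop_rightInvW`** — THE FIBRE-PRESERVING (TT): F71 at a pair with EQUAL tops, `τ = a·(curl1C∕(1−θℓ))·(M^d∕M²)·Λ`.
HONEST FRAMING (page 1): bookkeeping over tree identities; the pointed Landau representative (existence with the sup member) is NOT constructed here; (APE) NOT proved;
NOT ONE-STEP, NOT NE7; spine 0∕9; finite T⁴ rung (B)+1 — NOT infinite volume, NOT mass gap, NOT `BetaPertH`, NOT Clay.  Continuum YM on T⁴ ⇐ BetaPertH ∧ nine spine
estimates (0/9 proved); BetaPertH ⇐ (D1) ∧ (D4) ∧ CAP+tail; G-an2-4 gates asym, D1 and NE2/3/4.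
-/

set_option autoImplicit false

open scoped BigOperators Matrix.Norms.L2Operator
open NormedSpace Finset

namespace Summit.QuantumFields.BalabanUV.T4Continuum.NE7TopMismatchLetters

open Literature.MathematicalPhysics.QuantumFieldTheory.Balaban1983to89
open B7Prop1Explicit B7Prop2Explicit MatrixLog UnitaryModel
open T4AveragingDeficitWall (IsUnitaryCfg IsSkewDir SmallField Ad dirL1)
open T4AveragingDeficitWallBoundary (IsPeriodicCfg periodBox)
open AveragingDeficitPeriodicCounting (IsPeriodicDir)
open AveragingDeficitTransport (mem_U1_of_unitary)
open AveragingDeficitMultiLevelPrep (cavgIter LevelSmall cavgIter_unitary_small)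
open MinimalActionLevels (perWin)
open NE3TangentCovariantTower (dirIter QbarIter framePotW)
open NE3HessForm (dAction)
open NE3QbarIterCovLiftPrep (cruxC)
open NE3RightInverseSolveLetters (thetaLoc)
open NE3HatInvCurlLetters (curl1C curl1C_nonneg)
open NE3CpushGaugeCovariance (cavgIter_gaugeAct)
open NE7TangentTransportCurvedRightInv (tangent_transport_curved_rightInvW)

noncomputable section

variable {d : ℕ} {n : Type*} [Fintype n] [DecidableEq n]

/-! ## §1 The top mismatch of a representative over the same datum -/

/-- For a unitary bond variable and unitary site values: `‖g(z)·V·g(z+e_κ)⁻¹ − V‖ ≤ ‖g(z) − 1‖ + ‖g(z+e_κ) − 1‖`. [folklore] -/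
theorem norm_gaugeAct_sub_self_le [Nonempty n] {g : Site d → (Matrix n n ℂ)ˣ} (hg : ∀ y, g y ∈ unitaryUnits (Matrix n n ℂ))
    {V : Site d → Fin d → (Matrix n n ℂ)ˣ} (hV : IsUnitaryCfg V) (z : Site d) (κ : Fin d) :
    ‖((gaugeAct g V z κ : (Matrix n n ℂ)ˣ) : Matrix n n ℂ) - ((V z κ : (Matrix n n ℂ)ˣ) : Matrix n n ℂ)‖
      ≤ ‖((g z : (Matrix n n ℂ)ˣ) : Matrix n n ℂ) - 1‖ + ‖((g (z + e κ) : (Matrix n n ℂ)ˣ) : Matrix n n ℂ) - 1‖ := by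
  have hgU : ∀ y, g y ∈ U1 (Matrix n n ℂ) := fun y => mem_U1_of_unitary (hg y)
  have hVU : V z κ ∈ U1 (Matrix n n ℂ) := mem_U1_of_unitary (hV z κ)
  set a : Matrix n n ℂ := ((g z : (Matrix n n ℂ)ˣ) : Matrix n n ℂ) with ha
  set v : Matrix n n ℂ := ((V z κ : (Matrix n n ℂ)ˣ) : Matrix n n ℂ) with hv
  set binv : Matrix n n ℂ := (((g (z + e κ))⁻¹ : (Matrix n n ℂ)ˣ) : Matrix n n ℂ) with hbinv
  -- `a v b⁻¹ − v = (a − 1) v b⁻¹ + v (b⁻¹ − 1)`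
  have e1 : ((gaugeAct g V z κ : (Matrix n n ℂ)ˣ) : Matrix n n ℂ) - v = (a - 1) * v * binv + v * (binv - 1) := by
    simp only [gaugeAct, Units.val_mul, ha, hv, hbinv]
    noncomm_ring
  rw [e1]
  have h1 : ‖(a - 1) * v * binv‖ ≤ ‖a - 1‖ := by
    have hv1 : ‖v‖ ≤ 1 := (mem_U1.mp hVU).1
    have hb1 : ‖binv‖ ≤ 1 := (mem_U1.mp (hgU (z + e κ))).2
    have h0 : 0 ≤ ‖a - 1‖ := norm_nonneg _
    calc ‖(a - 1) * v * binv‖ ≤ ‖(a - 1) * v‖ * ‖binv‖ := norm_mul_le _ _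
      _ ≤ (‖a - 1‖ * ‖v‖) * ‖binv‖ := mul_le_mul_of_nonneg_right (norm_mul_le _ _) (norm_nonneg _)
      _ ≤ (‖a - 1‖ * 1) * 1 := mul_le_mul (mul_le_mul_of_nonneg_left hv1 h0) hb1 (norm_nonneg _) (by positivity)
      _ = ‖a - 1‖ := by ring
  have h2 : ‖v * (binv - 1)‖ ≤ ‖((g (z + e κ) : (Matrix n n ℂ)ˣ) : Matrix n n ℂ) - 1‖ := by
    calc ‖v * (binv - 1)‖ ≤ ‖v‖ * ‖binv - 1‖ := norm_mul_le _ _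
      _ ≤ 1 * ‖binv - 1‖ := mul_le_mul_of_nonneg_right (mem_U1.mp hVU).1 (norm_nonneg _)
      _ ≤ _ := by rw [one_mul, hbinv]; exact norm_inv_sub_one_le (hgU _)
  exact (norm_add_le _ _).trans (add_le_add h1 h2)

/-- **THE TOP MISMATCH OF A REPRESENTATIVE OVER THE SAME DATUM IS THE CORNER OSCILLATION OF ITS GAUGE**: `U`, `W` of the multi-level class with the SAME top
average `cavgIter L (k+1) U = cavgIter L (k+1) W`, `u` unitary with `‖u(M•z) − 1‖ ≤ θ` at the top corners (`M = L^{k+1}`).  Then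
`‖cavgIter L (k+1) (U^u) (z,κ) − cavgIter L (k+1) W (z,κ)‖ ≤ 2θ`. [folklore] -/
theorem norm_cavgIter_gaugeAct_sub_le [Nonempty n] {L : ℕ} (hL : 1 ≤ L) (k : ℕ) {U W : Site d → Fin d → (Matrix n n ℂ)ˣ} {x : ℝ}
    (hUu : IsUnitaryCfg U) (hx : 0 ≤ x) (hs : LevelSmall d L k x) (hUx : SmallField U x)
    (hTop : cavgIter L (k + 1) U = cavgIter L (k + 1) W)
    {u : Site d → (Matrix n n ℂ)ˣ} (hu : ∀ y, u y ∈ unitaryUnits (Matrix n n ℂ)) {θ : ℝ}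
    (hθ : ∀ z : Site d, ‖((u (((L : ℤ) ^ (k + 1)) • z) : (Matrix n n ℂ)ˣ) : Matrix n n ℂ) - 1‖ ≤ θ) (z : Site d) (κ : Fin d) :
    ‖((cavgIter L (k + 1) (gaugeAct u U) z κ : (Matrix n n ℂ)ˣ) : Matrix n n ℂ) - ((cavgIter L (k + 1) W z κ : (Matrix n n ℂ)ˣ) : Matrix n n ℂ)‖ ≤ 2 * θ := by
  have hTopU : IsUnitaryCfg (cavgIter L (k + 1) U) := (cavgIter_unitary_small hL k hUu hx hs hUx).1
  rw [cavgIter_gaugeAct hL k hUu hx hs hUx hu, ← hTop]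
  have h := norm_gaugeAct_sub_self_le (g := fun w => u (((L : ℤ) ^ (k + 1)) • w)) (fun y => hu _) hTopU z κ
  refine h.trans ?_
  have h1 := hθ z
  have h2 := hθ (z + e κ)
  linarith

/-- **A CORNER-PINNED GAUGE KEEPS THE TOP**: under the same data with `u(M•z) = 1` for all `z`, `cavgIter L (k+1) (U^u) = cavgIter L (k+1) W`. [folklore] -/
theorem cavgIter_gaugeAct_eq_of_pinned [Nonempty n] {L : ℕ} (hL : 1 ≤ L) (k : ℕ) {U W : Site d → Fin d → (Matrix n n ℂ)ˣ} {x : ℝ}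
    (hUu : IsUnitaryCfg U) (hx : 0 ≤ x) (hs : LevelSmall d L k x) (hUx : SmallField U x)
    (hTop : cavgIter L (k + 1) U = cavgIter L (k + 1) W)
    {u : Site d → (Matrix n n ℂ)ˣ} (hu : ∀ y, u y ∈ unitaryUnits (Matrix n n ℂ)) (hpin : ∀ z : Site d, u (((L : ℤ) ^ (k + 1)) • z) = 1) :
    cavgIter L (k + 1) (gaugeAct u U) = cavgIter L (k + 1) W := by
  rw [cavgIter_gaugeAct hL k hUu hx hs hUx hu, ← hTop]
  funext z κ
  simp only [gaugeAct, hpin, one_mul, inv_one, mul_one]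

/-! ## §2 THE FIBRE-PRESERVING (TT) -/

/-- **THE CURVED (TT) LETTER AT A PAIR WITH EQUAL TOPS** (`ω = 0` in F71): `L ≥ 2`; `U`, `W` unitary `(N·L^{k+1})`-periodic in the multi-level class at a common
radius `x` with the W5∕W6 regime, `SmallField U a`, and `cavgIter L (k+1) U = cavgIter L (k+1) W`; letters `C_F` (frame potential at `W` in `ℓ¹`; F72: `≤ 2dLK_maj`)
and `Λ` (straight towers; F73 in closed form).  THEN every skew periodic `Y` with `D_W Y = 0` has a skew periodic `Y′` with `D_U Y′ = 0` and
`|dAction U (Y′ − Y) (perWin d (N·L^{k+1}))| ≤ a·(curl1C∕(1−θℓ))·(M^d∕M²)·Λ·‖Y‖_{ℓ¹(periodBox (N·L^{k+1}))}`. [folklore] -/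
theorem tangent_transport_sameTop_rightInvW [Nonempty n] {L : ℕ} (hL : 2 ≤ L) (k : ℕ) {N : ℕ} [NeZero N]
    {U W : Site d → Fin d → (Matrix n n ℂ)ˣ} {x a : ℝ} (hUu : IsUnitaryCfg U) (hWu : IsUnitaryCfg W)
    (hUP : IsPeriodicCfg U ((N * L ^ (k + 1) : ℕ) : ℤ)) (hWP : IsPeriodicCfg W ((N * L ^ (k + 1) : ℕ) : ℤ))
    (hx : 0 ≤ x) (hs : LevelSmall d L k x) (hUx : SmallField U x) (hWx : SmallField W x)
    (hθ : cruxC d L * (((L : ℝ) ^ (k + 1)) ^ 2 * x) < 1) (hθl : thetaLoc d L * (((L : ℝ) ^ (k + 1)) ^ 2 * x) < 1)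
    (hε : ((L : ℝ) ^ (k + 1)) ^ 2 * x ≤ 1) (ha : 0 ≤ a) (hUa : SmallField U a)
    (hTop : cavgIter L (k + 1) U = cavgIter L (k + 1) W)
    {CF : ℝ}
    (hF : ∀ Y : Site d → Fin d → Matrix n n ℂ, IsSkewDir Y → IsPeriodicDir Y ((N * L ^ (k + 1) : ℕ) : ℤ) → dirIter L (k + 1) W Y = 0 →
      ∑ z ∈ periodBox (d := d) N, ‖framePotW L (k + 1) W Y z‖ ≤ CF * dirL1 Y (periodBox (d := d) (N * L ^ (k + 1))))
    {Λ : ℝ}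
    (hΛ : ∀ Y : Site d → Fin d → Matrix n n ℂ, IsSkewDir Y → IsPeriodicDir Y ((N * L ^ (k + 1) : ℕ) : ℤ) → dirIter L (k + 1) W Y = 0 →
      ∑ z ∈ periodBox N, ∑ κ : Fin d, ‖QbarIter L (k + 1) U Y z κ - QbarIter L (k + 1) W Y z κ‖
        ≤ Λ * dirL1 Y (periodBox (d := d) (N * L ^ (k + 1)))) :
    ∀ Y : Site d → Fin d → Matrix n n ℂ, IsSkewDir Y → IsPeriodicDir Y ((N * L ^ (k + 1) : ℕ) : ℤ) → dirIter L (k + 1) W Y = 0 →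
      ∃ Y' : Site d → Fin d → Matrix n n ℂ, IsSkewDir Y' ∧ IsPeriodicDir Y' ((N * L ^ (k + 1) : ℕ) : ℤ) ∧ dirIter L (k + 1) U Y' = 0 ∧
        |dAction U (fun y μ => Y' y μ - Y y μ) (perWin d (N * L ^ (k + 1)))|
          ≤ (a * ((curl1C d L / (1 - thetaLoc d L * (((L : ℝ) ^ (k + 1)) ^ 2 * x))) * (((L : ℝ) ^ (k + 1)) ^ d / ((L : ℝ) ^ (k + 1)) ^ 2)) * Λ)
            * dirL1 Y (periodBox (d := d) (N * L ^ (k + 1))) := by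
  intro Y hY hYP hYT
  have hTop0 : ∀ (z : Site d) (κ : Fin d),
      ‖((cavgIter L (k + 1) U z κ : (Matrix n n ℂ)ˣ) : Matrix n n ℂ) - ((cavgIter L (k + 1) W z κ : (Matrix n n ℂ)ˣ) : Matrix n n ℂ)‖ ≤ 0 := by
    intro z κ; rw [hTop, sub_self, norm_zero]
  obtain ⟨Y', h1, h2, h3, h4⟩ :=
    tangent_transport_curved_rightInvW hL k hUu hWu hUP hWP hx hs hUx hWx hθ hθl hε ha hUa le_rfl hTop0 hF hΛ Y hY hYP hYT
  refine ⟨Y', h1, h2, h3, h4.trans (le_of_eq ?_)⟩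
  ring

end

end Summit.QuantumFields.BalabanUV.T4Continuum.NE7TopMismatchLetters
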